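import Summits.QuantumFields.YangMills.Theorems.UnitScaleTiltProp7LemmaHCurvedFramesOfRegPr
import HarnessLib

/-!
# Route `UnitScaleTilt`, crux K1 «MinimiserStabilityRegPr» (stmt-QuantumFields-19200), route-R E′ path (α′), LEMMA-H-curved (design (x2′-corner)), file F-H8 —
# «(hD) → TRANSPORTS»: the frame value `Fr_y(x₀)` at any site reachable from the centre inside the support set IS the holonomy of the connecting lattice chain, up to `n·a₀`;
# hence ✓p661714∕`lemmaH_curved_of_pairRow`'s displayed pair row `D_y` is a TRANSPORTED coarse covariant difference plus `2n·a₀·‖ψ̊(c_y)‖`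

Cell `ym3-torus`, extra width seat `ym-routeR-w4` (g9); offered 2026-08-28 20:09Z («F-H8», GO-gated on ★p1 g15; ★routeR-w1 g5∕g6: «HIS, no twin»).  THEOREMS ONLY (0 `def`,
0 `sorry`); `--supports stmt-QuantumFields-19200`, count-neutral.  Everything here is a COROLLARY of the delivered frame package `(hFr)(hA)` (bi-contraction + the SIZE row
`a₀` on the support set) — no `∃` is reopened, no (3.35) letter is used: whoever holds frames with those two rows gets the transport row.  YM₃ on T³ is a ladder rung (R3),
not the Clay problem; nothing here claims LEMMA-H-curved, a stub, the crux or the gap.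

WHAT IS PROVED (ns `…Theorems.Prop7LemmaHCurvedTransportRow`).
* §1 (abstract carrier `S, ι, T, U`, `𝔸 : Type`) ★ `norm_hol_sub_frame_pair_le_fin` — the FINITE-chain form of ✓p662372 `norm_hol_sub_frame_pair_le`: recursions and local
  size rows only for the steps `i < n`: `‖H n − P(x 0)·P(x n)⁻¹‖ ≤ n·τ`.
* §2 (generic lattice `P`, height `k`) ★★ `transport_row_of_frameRows` — from `(hFr)` and the size half of `(hA)` (✓p661714's letters VERBATIM): for every centre `y`, every
  finite chain `x 0, …, x n` of forward∕backward shifts whose bond base points satisfy the support predicate of `y`, with holonomy `H` (DISPLAYED recursions):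
  `‖H n − Fr y (x 0)·(Fr y (x n))⁻¹‖ ≤ n·a₀`; ★★ `transport_row_to_centre` — with `x n = embIter k y` and `(hFr1)`: `‖H n − Fr y (x 0)‖ ≤ n·a₀`.
* §3 ★★★ `pairRow_of_transport` — the `(hD)` conversion: for bi-contractive `a := Fr y (embIter k y₀)` and `b := H n` with `‖b − a‖ ≤ n·a₀`, any datum `X` and central `c`:
  `‖R(a)X − X₀‖ ≤ ‖R(b)X − X₀‖ + 2(n·a₀)·‖X − c‖` — so `D_y := ‖R(H)ψ(c_y) − ψ(c_{y₀})‖ + 2n·a₀·‖ψ(c_y) − c_y‖` inhabits `(hD)` (the first term is the coarse covariant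
  difference with the chain's transport; at the knit `n ≤ 2d·L^{K−n}`, `a₀ ≍ α₀∕L^{K−n}` ⇒ `2n·a₀ = O(α₀)`, k-uniform).
HONEST SCOPE.  Triangle inequalities over ✓`Prop7ConjFrameTransition` ∕ ✓`B9Thm310CommutatorDataOfPlaquettes` letters; the identification of the chain holonomy with the
knit's coarse transport letter (`V_c` vs straight∕taxi transport, [Balaban1985Averaging] (19)–(21)) is the knit's.

References: T. Bałaban, CMP 99 (1985) 389–434 [Balaban1985BackgroundPropagators] ((3.35) p.396, (3.40) p.397); CMP 98 (1985) 17–51 [Balaban1985Averaging] ((19)–(21) p.21).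
-/

set_option autoImplicit false

noncomputable section

open scoped Matrix.Norms.L2Operator

namespace Summit.QuantumFields.YangMills.Theorems.Prop7LemmaHCurvedTransportRow

open Literature.MathematicalPhysics.QuantumFieldTheory.Balaban1983to89
open B9Eq39Adjoint (R R_def R_sub)
open B9Eq310Hermitian (norm_R_le)
open B9TorusCalculus (torusT)
open B5Eq118OneStroke (iterBlockOf)
open B15DeterminingSets (embIter)
open B9Thm310CommutatorDataOfPlaquettes (bicontr_mul bicontr_inv)
open Summit.QuantumFields.YangMills.Theorems.Prop7ConjFrameTransition (norm_mul_sub_one_le)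

/-! ## §1 The finite-chain kernel -/

section Chain

variable {𝔸 : Type} [NormedRing 𝔸] {S : Type*} {ι : Type*} (T : ι → Equiv.Perm S) (U : ι → S → 𝔸ˣ)

/-- ★ **FRAME VERSUS HOLONOMY ALONG A FINITE CHAIN** (recursions and local rows for `i < n` only): `‖H n − P(x 0)·P(x n)⁻¹‖ ≤ n·τ`.
[cite: Balaban1985BackgroundPropagators, (3.35) p.396, (3.40) p.397] -/
theorem norm_hol_sub_frame_pair_le_fin {P : S → 𝔸ˣ} (hP : ∀ z : S, ‖(P z : 𝔸)‖ ≤ 1 ∧ ‖(((P z)⁻¹ : 𝔸ˣ) : 𝔸)‖ ≤ 1)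
    (hU : ∀ (κ : ι) (z : S), ‖(U κ z : 𝔸)‖ ≤ 1 ∧ ‖(((U κ z)⁻¹ : 𝔸ˣ) : 𝔸)‖ ≤ 1)
    (x : ℕ → S) (μ : ℕ → ι) (fwd : ℕ → Bool) (H : ℕ → 𝔸ˣ) (n : ℕ)
    (hx : ∀ i, i < n → x (i + 1) = if fwd i then T (μ i) (x i) else (T (μ i)).symm (x i))
    (hH0 : H 0 = 1) (hHs : ∀ i, i < n → H (i + 1) = H i * (if fwd i then U (μ i) (x i) else (U (μ i) (x (i + 1)))⁻¹))
    {τ : ℝ} (hloc : ∀ i, i < n → ‖((((P (if fwd i then x i else x (i + 1)))⁻¹ * U (μ i) (if fwd i then x i else x (i + 1))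
        * P (T (μ i) (if fwd i then x i else x (i + 1))) : 𝔸ˣ) : 𝔸)) - 1‖ ≤ τ) :
    ‖((H n : 𝔸ˣ) : 𝔸) - ((P (x 0) * (P (x n))⁻¹ : 𝔸ˣ) : 𝔸)‖ ≤ n * τ := by
  -- `K i := (P x₀)⁻¹ · H i · P(x i)` stays within `i·τ` of `1` for `i ≤ n`
  have hK : ∀ i, i ≤ n → ‖((((P (x 0))⁻¹ * H i * P (x i) : 𝔸ˣ) : 𝔸)) - 1‖ ≤ i * τ := by
    intro i
    induction i with
    | zero => intro _; simp [hH0]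
    | succ i ih =>
      intro hi
      have hi' : i < n := Nat.lt_of_succ_le hi
      have ih' := ih hi'.le
      by_cases hf : fwd i = true
      · have hxi : x (i + 1) = T (μ i) (x i) := by simpa [hf] using hx i hi'
        have hrec : ((P (x 0))⁻¹ * H (i + 1) * P (x (i + 1)) : 𝔸ˣ)
            = ((P (x 0))⁻¹ * H i * P (x i)) * ((P (x i))⁻¹ * U (μ i) (x i) * P (T (μ i) (x i))) := by
          rw [hHs i hi', hxi]; simp [hf]; group
        have hli : ‖((((P (x i))⁻¹ * U (μ i) (x i) * P (T (μ i) (x i)) : 𝔸ˣ) : 𝔸)) - 1‖ ≤ τ := by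
          simpa [hf] using hloc i hi'
        have bh := bicontr_mul (bicontr_mul (bicontr_inv (hP (x i))) (hU (μ i) (x i))) (hP (T (μ i) (x i)))
        rw [hrec]
        calc _ ≤ _ := norm_mul_sub_one_le _ bh.1
          _ ≤ i * τ + τ := add_le_add ih' hli
          _ = (i + 1 : ℕ) * τ := by push_cast; ring
      · have hf' : fwd i = false := by simpa using hf
        have hxi : x (i + 1) = (T (μ i)).symm (x i) := by simpa [hf'] using hx i hi'
        have hTx : T (μ i) (x (i + 1)) = x i := by rw [hxi, Equiv.apply_symm_apply]
        have hrec : ((P (x 0))⁻¹ * H (i + 1) * P (x (i + 1)) : 𝔸ˣ)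
            = ((P (x 0))⁻¹ * H i * P (x i)) * ((P (x (i + 1)))⁻¹ * U (μ i) (x (i + 1)) * P (T (μ i) (x (i + 1))))⁻¹ := by
          rw [hHs i hi', hTx]; simp [hf']; group
        have hli : ‖((((P (x (i + 1)))⁻¹ * U (μ i) (x (i + 1)) * P (T (μ i) (x (i + 1))) : 𝔸ˣ) : 𝔸)) - 1‖ ≤ τ := by
          simpa [hf'] using hloc i hi'
        have bh := bicontr_mul (bicontr_mul (bicontr_inv (hP (x (i + 1)))) (hU (μ i) (x (i + 1)))) (hP (T (μ i) (x (i + 1))))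
        have hinv : ‖(((((P (x (i + 1)))⁻¹ * U (μ i) (x (i + 1)) * P (T (μ i) (x (i + 1))))⁻¹ : 𝔸ˣ) : 𝔸)) - 1‖ ≤ τ := by
          set h : 𝔸ˣ := (P (x (i + 1)))⁻¹ * U (μ i) (x (i + 1)) * P (T (μ i) (x (i + 1))) with hh
          have e : ((h⁻¹ : 𝔸ˣ) : 𝔸) - 1 = ((h⁻¹ : 𝔸ˣ) : 𝔸) * (1 - (h : 𝔸)) := by rw [mul_sub, mul_one, Units.inv_mul]
          rw [e]
          calc _ ≤ ‖((h⁻¹ : 𝔸ˣ) : 𝔸)‖ * ‖1 - (h : 𝔸)‖ := norm_mul_le _ _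
            _ ≤ 1 * ‖1 - (h : 𝔸)‖ := by gcongr; exact bh.2
            _ = ‖(h : 𝔸) - 1‖ := by rw [one_mul, norm_sub_rev]
            _ ≤ τ := hli
        rw [hrec]
        calc _ ≤ _ := norm_mul_sub_one_le _ bh.2
          _ ≤ i * τ + τ := add_le_add ih' hinv
          _ = (i + 1 : ℕ) * τ := by push_cast; ring
  have e1 : (P (x 0) : 𝔸) * ((((P (x 0))⁻¹ * H n * P (x n) : 𝔸ˣ) : 𝔸)) * (((P (x n))⁻¹ : 𝔸ˣ) : 𝔸) = (H n : 𝔸) := by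
    rw [← Units.val_mul, ← Units.val_mul]
    congr 1
    group
  have e : ((H n : 𝔸ˣ) : 𝔸) - ((P (x 0) * (P (x n))⁻¹ : 𝔸ˣ) : 𝔸)
      = (P (x 0) : 𝔸) * (((((P (x 0))⁻¹ * H n * P (x n) : 𝔸ˣ) : 𝔸)) - 1) * (((P (x n))⁻¹ : 𝔸ˣ) : 𝔸) := by
    rw [mul_sub, sub_mul, mul_one, e1, Units.val_mul]
  rw [e]
  calc _ ≤ ‖(P (x 0) : 𝔸) * (((((P (x 0))⁻¹ * H n * P (x n) : 𝔸ˣ) : 𝔸)) - 1)‖ * ‖(((P (x n))⁻¹ : 𝔸ˣ) : 𝔸)‖ := norm_mul_le _ _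
    _ ≤ (‖(P (x 0) : 𝔸)‖ * ‖((((P (x 0))⁻¹ * H n * P (x n) : 𝔸ˣ) : 𝔸)) - 1‖) * 1 := by gcongr; exacts [norm_mul_le _ _, (hP (x n)).2]
    _ ≤ (1 * (n * τ)) * 1 := by gcongr; exacts [(hP (x 0)).1, hK n le_rfl]
    _ = n * τ := by ring

omit T U in
/-- ★★★ **THE PAIR-ROW CONVERSION**: `‖R(a)X − X₀‖ ≤ ‖R(b)X − X₀‖ + 2‖b − a‖·‖X − c‖` for bi-contractive units `a, b` and central `c` (`R(a)X − R(b)X = R(a)(X−c) − R(b)(X−c)`).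
[cite: Balaban1985BackgroundPropagators, (3.3) p.390 (bookkeeping)] -/
theorem pairRow_of_transport {a b : 𝔸ˣ} (ha : ‖(a : 𝔸)‖ ≤ 1 ∧ ‖((a⁻¹ : 𝔸ˣ) : 𝔸)‖ ≤ 1) (hb : ‖(b : 𝔸)‖ ≤ 1 ∧ ‖((b⁻¹ : 𝔸ˣ) : 𝔸)‖ ≤ 1)
    (X X₀ c : 𝔸) (hc : ∀ w : 𝔸, Commute c w) :
    ‖R a X - X₀‖ ≤ ‖R b X - X₀‖ + 2 * ‖(b : 𝔸) - a‖ * ‖X - c‖ := by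
  -- `R u c = c`
  have hRc : ∀ u : 𝔸ˣ, R u c = c := fun u => by
    rw [R_def, ← (hc (u : 𝔸)).eq, mul_assoc, Units.mul_inv, mul_one]
  -- `‖R(a)w − R(b)w‖ ≤ 2‖a − b‖‖w‖`
  have hRR : ∀ w : 𝔸, ‖R a w - R b w‖ ≤ 2 * ‖(b : 𝔸) - a‖ * ‖w‖ := by
    intro w
    have e : R a w - R b w = ((a : 𝔸) - b) * w * ((a⁻¹ : 𝔸ˣ) : 𝔸)
        + (b : 𝔸) * w * (((a⁻¹ : 𝔸ˣ) : 𝔸) * ((b : 𝔸) - a) * ((b⁻¹ : 𝔸ˣ) : 𝔸)) := by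
      have h1 : ((a⁻¹ : 𝔸ˣ) : 𝔸) * ((b : 𝔸) - a) * ((b⁻¹ : 𝔸ˣ) : 𝔸) = ((a⁻¹ : 𝔸ˣ) : 𝔸) - ((b⁻¹ : 𝔸ˣ) : 𝔸) := by
        rw [mul_sub, sub_mul, mul_assoc, Units.mul_inv, mul_one, Units.inv_mul, one_mul]
      rw [h1, R_def, R_def]
      noncomm_ring
    rw [e]
    have n1 : ‖((a : 𝔸) - b) * w * ((a⁻¹ : 𝔸ˣ) : 𝔸)‖ ≤ ‖(b : 𝔸) - a‖ * ‖w‖ := by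
      calc _ ≤ ‖((a : 𝔸) - b) * w‖ * ‖((a⁻¹ : 𝔸ˣ) : 𝔸)‖ := norm_mul_le _ _
        _ ≤ (‖(a : 𝔸) - b‖ * ‖w‖) * 1 := by gcongr; exacts [norm_mul_le _ _, ha.2]
        _ = ‖(b : 𝔸) - a‖ * ‖w‖ := by rw [mul_one, norm_sub_rev]
    have n2 : ‖(b : 𝔸) * w * (((a⁻¹ : 𝔸ˣ) : 𝔸) * ((b : 𝔸) - a) * ((b⁻¹ : 𝔸ˣ) : 𝔸))‖ ≤ ‖(b : 𝔸) - a‖ * ‖w‖ := by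
      have n3 : ‖((a⁻¹ : 𝔸ˣ) : 𝔸) * ((b : 𝔸) - a) * ((b⁻¹ : 𝔸ˣ) : 𝔸)‖ ≤ ‖(b : 𝔸) - a‖ := by
        calc _ ≤ ‖((a⁻¹ : 𝔸ˣ) : 𝔸) * ((b : 𝔸) - a)‖ * ‖((b⁻¹ : 𝔸ˣ) : 𝔸)‖ := norm_mul_le _ _
          _ ≤ (‖((a⁻¹ : 𝔸ˣ) : 𝔸)‖ * ‖(b : 𝔸) - a‖) * 1 := by gcongr; exacts [norm_mul_le _ _, hb.2]
          _ ≤ (1 * ‖(b : 𝔸) - a‖) * 1 := by gcongr; exact ha.2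
          _ = ‖(b : 𝔸) - a‖ := by ring
      calc _ ≤ ‖(b : 𝔸) * w‖ * ‖((a⁻¹ : 𝔸ˣ) : 𝔸) * ((b : 𝔸) - a) * ((b⁻¹ : 𝔸ˣ) : 𝔸)‖ := norm_mul_le _ _
        _ ≤ (‖(b : 𝔸)‖ * ‖w‖) * ‖(b : 𝔸) - a‖ := by gcongr; exact norm_mul_le _ _
        _ ≤ (1 * ‖w‖) * ‖(b : 𝔸) - a‖ := by gcongr; exact hb.1
        _ = ‖(b : 𝔸) - a‖ * ‖w‖ := by ring
    exact (norm_add_le _ _).trans (by linarith)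
  have hsplit : R a X - X₀ = (R b X - X₀) + (R a (X - c) - R b (X - c)) := by
    rw [R_sub, R_sub, hRc a, hRc b]; abel
  rw [hsplit]
  exact (norm_add_le _ _).trans (add_le_add le_rfl (hRR _))

end Chain

/-! ## §2 The transport row from the frame rows (generic lattice) -/

section Generic

variable {P : Params} {k : ℕ}
variable {𝔸 : Type} [NormedRing 𝔸]

/-- ★★ **TRANSPORT ROW FROM `(hFr)` + THE SIZE HALF OF `(hA)`**: for every centre `y` and every finite chain whose bond base points satisfy ✓p661714's support predicate of `y`,
`‖H n − Fr y (x 0)·(Fr y (x n))⁻¹‖ ≤ n·a₀`. [cite: Balaban1985BackgroundPropagators, (3.35) p.396, (3.40) p.397] -/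
theorem transport_row_of_frameRows (U : Fin P.d → Site P 0 → 𝔸ˣ)
    (hU : ∀ (κ : Fin P.d) (z : Site P 0), ‖(U κ z : 𝔸)‖ ≤ 1 ∧ ‖(((U κ z)⁻¹ : 𝔸ˣ) : 𝔸)‖ ≤ 1)
    (Fr : Site P k → Site P 0 → 𝔸ˣ) (hFr : ∀ y z, ‖(Fr y z : 𝔸)‖ ≤ 1 ∧ ‖(((Fr y z)⁻¹ : 𝔸ˣ) : 𝔸)‖ ≤ 1) {a₀ : ℝ}
    (hA0 : ∀ (y : Site P k) (z : Site P 0), (∀ ν : Fin P.d, (y ν = (iterBlockOf k (fun κ => z κ - ((((P.L ^ k - 1) / 2 : ℕ)) : ZMod (P.sitesPerDir 0)))) ν - 1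
          ∨ y ν = (iterBlockOf k (fun κ => z κ - ((((P.L ^ k - 1) / 2 : ℕ)) : ZMod (P.sitesPerDir 0)))) ν
          ∨ y ν = (iterBlockOf k (fun κ => z κ - ((((P.L ^ k - 1) / 2 : ℕ)) : ZMod (P.sitesPerDir 0)))) ν + 1
          ∨ y ν = (iterBlockOf k (fun κ => z κ - ((((P.L ^ k - 1) / 2 : ℕ)) : ZMod (P.sitesPerDir 0)))) ν + 2)) →
        ∀ μ : Fin P.d, ‖(((Fr y z)⁻¹ * U μ z * Fr y (torusT P 0 μ z) : 𝔸ˣ) : 𝔸) - 1‖ ≤ a₀)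
    (y : Site P k) (x : ℕ → Site P 0) (μ : ℕ → Fin P.d) (fwd : ℕ → Bool) (H : ℕ → 𝔸ˣ) (n : ℕ)
    (hx : ∀ i, i < n → x (i + 1) = if fwd i then torusT P 0 (μ i) (x i) else (torusT P 0 (μ i)).symm (x i))
    (hH0 : H 0 = 1) (hHs : ∀ i, i < n → H (i + 1) = H i * (if fwd i then U (μ i) (x i) else (U (μ i) (x (i + 1)))⁻¹))
    (hsupp : ∀ i, i < n → ∀ ν : Fin P.d,
      (y ν = (iterBlockOf k (fun κ => (if fwd i then x i else x (i + 1)) κ - ((((P.L ^ k - 1) / 2 : ℕ)) : ZMod (P.sitesPerDir 0)))) ν - 1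
      ∨ y ν = (iterBlockOf k (fun κ => (if fwd i then x i else x (i + 1)) κ - ((((P.L ^ k - 1) / 2 : ℕ)) : ZMod (P.sitesPerDir 0)))) ν
      ∨ y ν = (iterBlockOf k (fun κ => (if fwd i then x i else x (i + 1)) κ - ((((P.L ^ k - 1) / 2 : ℕ)) : ZMod (P.sitesPerDir 0)))) ν + 1
      ∨ y ν = (iterBlockOf k (fun κ => (if fwd i then x i else x (i + 1)) κ - ((((P.L ^ k - 1) / 2 : ℕ)) : ZMod (P.sitesPerDir 0)))) ν + 2)) :
    ‖((H n : 𝔸ˣ) : 𝔸) - ((Fr y (x 0) * (Fr y (x n))⁻¹ : 𝔸ˣ) : 𝔸)‖ ≤ n * a₀ :=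
  norm_hol_sub_frame_pair_le_fin (torusT P 0) U (hFr y) hU x μ fwd H n hx hH0 hHs
    (fun i hi => hA0 y _ (hsupp i hi) (μ i))

/-- ★★ **TRANSPORT TO THE CENTRE**: if the chain ends at the centre (`x n = embIter k y`, `Fr y (embIter k y) = 1`) then `‖H n − Fr y (x 0)‖ ≤ n·a₀` — the frame value at
`x 0` IS the chain's holonomy up to `n·a₀`. [cite: Balaban1985BackgroundPropagators, (3.35) p.396, (3.40) p.397] -/
theorem transport_row_to_centre (U : Fin P.d → Site P 0 → 𝔸ˣ)
    (hU : ∀ (κ : Fin P.d) (z : Site P 0), ‖(U κ z : 𝔸)‖ ≤ 1 ∧ ‖(((U κ z)⁻¹ : 𝔸ˣ) : 𝔸)‖ ≤ 1)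
    (Fr : Site P k → Site P 0 → 𝔸ˣ) (hFr : ∀ y z, ‖(Fr y z : 𝔸)‖ ≤ 1 ∧ ‖(((Fr y z)⁻¹ : 𝔸ˣ) : 𝔸)‖ ≤ 1) (hFr1 : ∀ y, Fr y (embIter k y) = 1)
    {a₀ : ℝ}
    (hA0 : ∀ (y : Site P k) (z : Site P 0), (∀ ν : Fin P.d, (y ν = (iterBlockOf k (fun κ => z κ - ((((P.L ^ k - 1) / 2 : ℕ)) : ZMod (P.sitesPerDir 0)))) ν - 1
          ∨ y ν = (iterBlockOf k (fun κ => z κ - ((((P.L ^ k - 1) / 2 : ℕ)) : ZMod (P.sitesPerDir 0)))) ν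
          ∨ y ν = (iterBlockOf k (fun κ => z κ - ((((P.L ^ k - 1) / 2 : ℕ)) : ZMod (P.sitesPerDir 0)))) ν + 1
          ∨ y ν = (iterBlockOf k (fun κ => z κ - ((((P.L ^ k - 1) / 2 : ℕ)) : ZMod (P.sitesPerDir 0)))) ν + 2)) →
        ∀ μ : Fin P.d, ‖(((Fr y z)⁻¹ * U μ z * Fr y (torusT P 0 μ z) : 𝔸ˣ) : 𝔸) - 1‖ ≤ a₀)
    (y : Site P k) (x : ℕ → Site P 0) (μ : ℕ → Fin P.d) (fwd : ℕ → Bool) (H : ℕ → 𝔸ˣ) (n : ℕ) (hxn : x n = embIter k y)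
    (hx : ∀ i, i < n → x (i + 1) = if fwd i then torusT P 0 (μ i) (x i) else (torusT P 0 (μ i)).symm (x i))
    (hH0 : H 0 = 1) (hHs : ∀ i, i < n → H (i + 1) = H i * (if fwd i then U (μ i) (x i) else (U (μ i) (x (i + 1)))⁻¹))
    (hsupp : ∀ i, i < n → ∀ ν : Fin P.d,
      (y ν = (iterBlockOf k (fun κ => (if fwd i then x i else x (i + 1)) κ - ((((P.L ^ k - 1) / 2 : ℕ)) : ZMod (P.sitesPerDir 0)))) ν - 1
      ∨ y ν = (iterBlockOf k (fun κ => (if fwd i then x i else x (i + 1)) κ - ((((P.L ^ k - 1) / 2 : ℕ)) : ZMod (P.sitesPerDir 0)))) ν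
      ∨ y ν = (iterBlockOf k (fun κ => (if fwd i then x i else x (i + 1)) κ - ((((P.L ^ k - 1) / 2 : ℕ)) : ZMod (P.sitesPerDir 0)))) ν + 1
      ∨ y ν = (iterBlockOf k (fun κ => (if fwd i then x i else x (i + 1)) κ - ((((P.L ^ k - 1) / 2 : ℕ)) : ZMod (P.sitesPerDir 0)))) ν + 2)) :
    ‖((H n : 𝔸ˣ) : 𝔸) - (Fr y (x 0) : 𝔸)‖ ≤ n * a₀ := by
  have h := transport_row_of_frameRows U hU Fr hFr hA0 y x μ fwd H n hx hH0 hHs hsupp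
  rwa [hxn, hFr1 y, inv_one, mul_one] at h

/-- ★★★ **`(hD)` FROM A TRANSPORTED COARSE DIFFERENCE**: under the hypotheses of `transport_row_to_centre` with `x 0 = embIter k y₀`, for the centre data `ψ` and any central `c`:
`‖R(Fr y (embIter k y₀)) (ψ(embIter k y)) − ψ(embIter k y₀)‖ ≤ ‖R(H n)(ψ(embIter k y)) − ψ(embIter k y₀)‖ + 2(n·a₀)·‖ψ(embIter k y) − c‖` — ✓`lemmaH_curved_of_pairRow`'s
displayed `D_y` inhabited by the chain-transported coarse covariant difference plus `O(n·a₀)‖ψ̊‖`. [cite: Balaban1985BackgroundPropagators, (3.40) p.397; Balaban1985Averaging, (19)-(21) p.21] -/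
theorem pairRow_of_frameRows (U : Fin P.d → Site P 0 → 𝔸ˣ)
    (hU : ∀ (κ : Fin P.d) (z : Site P 0), ‖(U κ z : 𝔸)‖ ≤ 1 ∧ ‖(((U κ z)⁻¹ : 𝔸ˣ) : 𝔸)‖ ≤ 1)
    (Fr : Site P k → Site P 0 → 𝔸ˣ) (hFr : ∀ y z, ‖(Fr y z : 𝔸)‖ ≤ 1 ∧ ‖(((Fr y z)⁻¹ : 𝔸ˣ) : 𝔸)‖ ≤ 1) (hFr1 : ∀ y, Fr y (embIter k y) = 1)
    {a₀ : ℝ}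
    (hA0 : ∀ (y : Site P k) (z : Site P 0), (∀ ν : Fin P.d, (y ν = (iterBlockOf k (fun κ => z κ - ((((P.L ^ k - 1) / 2 : ℕ)) : ZMod (P.sitesPerDir 0)))) ν - 1
          ∨ y ν = (iterBlockOf k (fun κ => z κ - ((((P.L ^ k - 1) / 2 : ℕ)) : ZMod (P.sitesPerDir 0)))) ν
          ∨ y ν = (iterBlockOf k (fun κ => z κ - ((((P.L ^ k - 1) / 2 : ℕ)) : ZMod (P.sitesPerDir 0)))) ν + 1
          ∨ y ν = (iterBlockOf k (fun κ => z κ - ((((P.L ^ k - 1) / 2 : ℕ)) : ZMod (P.sitesPerDir 0)))) ν + 2)) →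
        ∀ μ : Fin P.d, ‖(((Fr y z)⁻¹ * U μ z * Fr y (torusT P 0 μ z) : 𝔸ˣ) : 𝔸) - 1‖ ≤ a₀)
    (y y₀ : Site P k) (x : ℕ → Site P 0) (μ : ℕ → Fin P.d) (fwd : ℕ → Bool) (H : ℕ → 𝔸ˣ) (n : ℕ)
    (hx0 : x 0 = embIter k y₀) (hxn : x n = embIter k y)
    (hx : ∀ i, i < n → x (i + 1) = if fwd i then torusT P 0 (μ i) (x i) else (torusT P 0 (μ i)).symm (x i))
    (hH0 : H 0 = 1) (hHs : ∀ i, i < n → H (i + 1) = H i * (if fwd i then U (μ i) (x i) else (U (μ i) (x (i + 1)))⁻¹))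
    (hsupp : ∀ i, i < n → ∀ ν : Fin P.d,
      (y ν = (iterBlockOf k (fun κ => (if fwd i then x i else x (i + 1)) κ - ((((P.L ^ k - 1) / 2 : ℕ)) : ZMod (P.sitesPerDir 0)))) ν - 1
      ∨ y ν = (iterBlockOf k (fun κ => (if fwd i then x i else x (i + 1)) κ - ((((P.L ^ k - 1) / 2 : ℕ)) : ZMod (P.sitesPerDir 0)))) ν
      ∨ y ν = (iterBlockOf k (fun κ => (if fwd i then x i else x (i + 1)) κ - ((((P.L ^ k - 1) / 2 : ℕ)) : ZMod (P.sitesPerDir 0)))) ν + 1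
      ∨ y ν = (iterBlockOf k (fun κ => (if fwd i then x i else x (i + 1)) κ - ((((P.L ^ k - 1) / 2 : ℕ)) : ZMod (P.sitesPerDir 0)))) ν + 2))
    (ψ : Site P 0 → 𝔸) (c : 𝔸) (hc : ∀ w : 𝔸, Commute c w) :
    ‖R (Fr y (embIter k y₀)) (ψ (embIter k y)) - ψ (embIter k y₀)‖
      ≤ ‖R (H n) (ψ (embIter k y)) - ψ (embIter k y₀)‖ + 2 * (n * a₀) * ‖ψ (embIter k y) - c‖ := by
  have ht := transport_row_to_centre U hU Fr hFr hFr1 hA0 y x μ fwd H n hxn hx hH0 hHs hsupp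
  rw [hx0] at ht
  -- bi-contraction of `H n` (a product of bi-contractive bond units)
  have hHb : ∀ i, i ≤ n → ‖(H i : 𝔸)‖ ≤ 1 ∧ ‖(((H i)⁻¹ : 𝔸ˣ) : 𝔸)‖ ≤ 1 := by
    intro i
    induction i with
    | zero => intro _; rw [hH0]; exact bicontr_inv (bicontr_mul (bicontr_inv (hFr y (x 0))) (hFr y (x 0))) |>.imp (fun h => by simpa using h) (fun h => by simpa using h)
    | succ i ih =>
      intro hi
      have hi' : i < n := Nat.lt_of_succ_le hi
      rw [hHs i hi']
      refine bicontr_mul (ih hi'.le) ?_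
      split
      · exact hU _ _
      · exact bicontr_inv (hU _ _)
  have h := pairRow_of_transport (hFr y (embIter k y₀)) (hHb n le_rfl) (ψ (embIter k y)) (ψ (embIter k y₀)) c hc
  calc _ ≤ ‖R (H n) (ψ (embIter k y)) - ψ (embIter k y₀)‖ + 2 * ‖((H n : 𝔸ˣ) : 𝔸) - (Fr y (embIter k y₀) : 𝔸)‖ * ‖ψ (embIter k y) - c‖ := h
    _ ≤ _ := by gcongr

end Generic

/-! ## §3 (APPEND v1.1) The pair row in COMMUTATOR form (ym-routeR-w1 g6's (R4′) LOCATE §7: `D_y ≤ ‖R(H)m_y − m_{y₀}‖ + N_{m_y}(·)`, no `2n·a₀‖ψ̊‖`) -/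

section Comm

variable {𝔸 : Type} [NormedRing 𝔸]

/-- `R(g)X − X = (gX − Xg)·g⁻¹`, so `‖R(g)X − X‖ ≤ ‖gX − Xg‖` for bi-contractive `g` — the commutator currency of a conjugation defect. [folklore] -/
theorem norm_R_sub_self_le_comm {g : 𝔸ˣ} (hg : ‖(g : 𝔸)‖ ≤ 1 ∧ ‖((g⁻¹ : 𝔸ˣ) : 𝔸)‖ ≤ 1) (X : 𝔸) :
    ‖R g X - X‖ ≤ ‖(g : 𝔸) * X - X * (g : 𝔸)‖ := by
  have e : R g X - X = ((g : 𝔸) * X - X * (g : 𝔸)) * ((g⁻¹ : 𝔸ˣ) : 𝔸) := by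
    rw [Prop7ConjFrameTransport.R_sub_self_eq_comm_mul]
    congr 1
    noncomm_ring
  rw [e]
  calc _ ≤ ‖(g : 𝔸) * X - X * (g : 𝔸)‖ * ‖((g⁻¹ : 𝔸ˣ) : 𝔸)‖ := norm_mul_le _ _
    _ ≤ ‖(g : 𝔸) * X - X * (g : 𝔸)‖ * 1 := by gcongr; exact hg.2
    _ = _ := mul_one _

/-- ★★ **THE PAIR-ROW CONVERSION IN COMMUTATOR CURRENCY**: `‖R(a)X − X₀‖ ≤ ‖R(b)X − X₀‖ + ‖(b⁻¹a)X − X(b⁻¹a)‖` for bi-contractive `a, b` — the defect between the frame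
transport `a = Fr_y(c_{y₀})` and the chain holonomy `b = H_n` enters only through the commutator of `b⁻¹a` with the datum (zero on data aligned with it), not through
`‖b − a‖·‖X̊‖`. [cite: Balaban1985BackgroundPropagators, (3.3) p.390 (bookkeeping)] -/
theorem pairRow_of_transport_comm {a b : 𝔸ˣ} (ha : ‖(a : 𝔸)‖ ≤ 1 ∧ ‖((a⁻¹ : 𝔸ˣ) : 𝔸)‖ ≤ 1) (hb : ‖(b : 𝔸)‖ ≤ 1 ∧ ‖((b⁻¹ : 𝔸ˣ) : 𝔸)‖ ≤ 1)
    (X X₀ : 𝔸) :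
    ‖R a X - X₀‖ ≤ ‖R b X - X₀‖ + ‖(((b⁻¹ * a : 𝔸ˣ)) : 𝔸) * X - X * (((b⁻¹ * a : 𝔸ˣ)) : 𝔸)‖ := by
  have hsplit : R a X - X₀ = (R b X - X₀) + R b (R (b⁻¹ * a) X - X) := by
    rw [R_sub, ← B9Eq39Adjoint.R_mul, mul_inv_cancel_left]; abel
  rw [hsplit]
  refine (norm_add_le _ _).trans (add_le_add le_rfl ?_)
  have hg := bicontr_mul (bicontr_inv hb) ha
  exact (norm_R_le hb.1 hb.2 _).trans (norm_R_sub_self_le_comm hg X)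

end Comm

end Summit.QuantumFields.YangMills.Theorems.Prop7LemmaHCurvedTransportRow

end
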